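import Literature.NumberTheory.EllipticCurves.TateCurve.UniformizationAlgebraic
import Literature.NumberTheory.EllipticCurves.TateCurve.UniformizationFormalGroup
import HarnessLib

/-!
# `E_{q,1} = φ(1 + 𝔪)`: a point of the Tate curve with `‖x‖ > 1` is `φ(u)` for a principal unit `u`
# — over a complete field and over an algebraic extension (Silverman, *ATAEC* §V.4; theorems only)

Topic `Literature/NumberTheory/EllipticCurves/TateCurve`, namespace
`Literature.NumberTheory.EllipticCurves.TateCurve` (LEAD `bsd-wall-utd-p1` g26, crux r205
stmt-BirchSwinnertonDyer-24737 `TwinAlgMuZeroAtThree`, line `beta-road`: the converse half of the Tate-reduction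
adapter — together with `NumberFieldUniformization{,Twisted}KernelOfReduction` (`Ψ(1 + 𝔪) ⊆ E₁`) it identifies
Greenberg's kernel-of-reduction datum `E[p^∞] ∩ E₁(K̄_v)` with the Tate datum `Ψ(μ_{p^∞})`).

abc-iut-L2-t6's `exists_tate_eq_of_one_lt_norm` (ATAEC §V.4 p. 401: «`φ(R₁^*) = E_{q,1}(K)`», Newton–Hensel on the
one-units) is stated for a complete field with the on-curve identity as a hypothesis; here it is packaged for Tate's
point maps:

* `exists_oneUnit_tatePoint_eq_of_one_lt_norm` — complete `K`: a point `(x, y)` of `E_q(K)` with `‖x‖ > 1` is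
  `tatePoint q u` for some `u` with `‖u − 1‖ < 1`;
* **`exists_oneUnit_tatePointAlg_eq_of_one_lt_norm`** — the same for `tatePointAlg q` over an ALGEBRAIC ultrametric
  normed extension `F` of `K` (e.g. `K̄`), «we are really working in the complete field `K(x, y)`».

BSD is not proved by any of this.

## References
* [SilvermanATAEC1994] J. H. Silverman, *Advanced Topics in the Arithmetic of Elliptic Curves*, GTM 151, Springer
  1994, Thm. V.3.1 (c) (PDF pp. 395–399), §V.4 (PDF p. 401).
-/

noncomputable section

open scoped Classical

namespace Literature.NumberTheory.EllipticCurves.TateCurve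

open SteinWuthrich2013 WeierstrassCurve

universe u

/-! ## §1 Complete field -/

section Complete

variable {K : Type u} [NontriviallyNormedField K] [CompleteSpace K] [IsUltrametricDist K] [CharZero K]
  {q : K}

/-- **`E_{q,1}(K) ⊆ φ(1 + 𝔪)` over a complete field**: a point `(x, y)` of the Tate curve `E_q(K)` with
`‖x‖ > 1` is `tatePoint q u` for a (unique) principal unit `u`, `‖u − 1‖ < 1` (ATAEC §V.4, «`φ(R₁^*) = E_{q,1}(K)`»;
abc-iut-L2-t6's Newton–Hensel `exists_tate_eq_of_one_lt_norm` with the on-curve identity `tate_onCurve`).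
[cite: SilvermanATAEC1994, §V.4 (PDF p. 401)] -/
theorem exists_oneUnit_tatePoint_eq_of_one_lt_norm (hq0 : q ≠ 0) (hq : ‖q‖ < 1) {x y : K}
    (h : (tateCurve q).toAffine.Nonsingular x y) (hx : 1 < ‖x‖) :
    ∃ u : Kˣ, ‖(u : K) - 1‖ < 1 ∧ tatePoint q u = .some x y h := by
  have h12 : (12 : K) ≠ 0 := by norm_num
  have hxy : y ^ 2 + x * y = x ^ 3 + tateA4 q * x + tateA6 q := by
    have h' := h.1
    rw [WeierstrassCurve.Affine.equation_iff] at h'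
    simp only [tateCurve] at h'
    linear_combination h'
  have honCurve : ∀ u : K, ‖u‖ = 1 → u ≠ 1 →
      tateY q u ^ 2 + tateX q u * tateY q u = tateX q u ^ 3 + tateA4 q * tateX q u + tateA6 q := by
    intro u hu hu1
    have hu0 : u ≠ 0 := norm_pos_iff.mp (by rw [hu]; exact one_pos)
    have h := tate_onCurve hq0 hq h12 (Units.mk0 u hu0)
      (fun n => by rw [Units.val_mk0]; exact ne_zpow_of_norm_eq_one hq hu hu1 n)
    simpa only [Units.val_mk0] using h
  obtain ⟨t, ht0, ht, hX, hY⟩ := exists_tate_eq_of_one_lt_norm h12 hq honCurve hxy hx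
  have h1t : ‖(1 : K) + t‖ = 1 := norm_one_add_eq_one ht
  have h1t0 : (1 : K) + t ≠ 0 := norm_pos_iff.mp (by rw [h1t]; exact one_pos)
  have h1t1 : (1 : K) + t ≠ 1 := fun h => ht0 (by simpa using h)
  refine ⟨Units.mk0 (1 + t) h1t0, by rw [Units.val_mk0, add_sub_cancel_left]; exact ht, ?_⟩
  have hu : ∀ n : ℤ, ((Units.mk0 (1 + t) h1t0 : Kˣ) : K) ≠ q ^ n := fun n => by
    rw [Units.val_mk0]; exact ne_zpow_of_norm_eq_one hq h1t h1t1 n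
  rw [tatePoint_of_ne_zpow hq0 hq _ hu]
  simp only [Affine.Point.some.injEq, Units.val_mk0]
  exact ⟨hX, hY⟩

end Complete

/-! ## §2 Algebraic extension -/

section Algebraic

variable {K : Type u} [NontriviallyNormedField K] [CompleteSpace K] [IsUltrametricDist K]
  [CharZero K] {F : Type u} [NormedField F] [NormedAlgebra K F] [IsUltrametricDist F]
  [Algebra.IsAlgebraic K F] {q : K}

section Compare

variable {E : Type u} [NontriviallyNormedField E] [CompleteSpace E] [IsUltrametricDist E] [CharZero E]
  [Algebra K E] (ι : E →ₐ[K] F) (hι : ∀ x, ‖ι x‖ = ‖x‖)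

include hι in
omit [IsUltrametricDist F] in
/-- **Transfer of `E_{q,1} ⊆ φ(1 + 𝔪)` from a complete subfield**: an `E`-rational point `(x, y)` of `(E_q)_{/E}` with
`‖x‖ > 1`, pushed to `F`, is `φ_F(ι v)` for a principal unit `v ∈ Eˣ` (`exists_oneUnit_tatePoint_eq_of_one_lt_norm` in `E`,
`map_tatePoint_eq`). [cite: SilvermanATAEC1994, §V.4 (PDF p. 401), Thm. V.3.1 (c) (PDF p. 396)] -/
theorem exists_oneUnit_tatePointAlg_map_eq (hq0 : q ≠ 0) (hq : ‖q‖ < 1) {x y : E}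
    (hE : ((tateCurve q).baseChange E).toAffine.Nonsingular x y) (hx : 1 < ‖x‖) :
    ∃ v : Eˣ, ‖(v : E) - 1‖ < 1 ∧
      tatePointAlg q (Units.map (ι : E →* F) v) = Affine.Point.map ι (.some x y hE) := by
  have hqE : ‖algebraMap K E q‖ < 1 := by rwa [norm_algebraMap_eq_of_norm_map_eq ι hι]
  have hqE0 : algebraMap K E q ≠ 0 := (map_ne_zero _).mpr hq0
  -- round trip of the transport along `(E_q)_{/E} = E_{q_E}`
  have hrt : ∀ {W₁ W₂ : WeierstrassCurve E} (h : W₁ = W₂) (P : W₁.toAffine.Point),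
      Affine.Point.congrEquiv h.symm (Affine.Point.congrEquiv h P) = P := by
    intro W₁ W₂ h P
    subst h
    rfl
  have hE' : (tateCurve (algebraMap K E q)).toAffine.Nonsingular x y := by
    rw [← tateCurve_baseChange_eq ι hι hq]; exact hE
  obtain ⟨v, hv1, hv⟩ := exists_oneUnit_tatePoint_eq_of_one_lt_norm hqE0 hqE hE' hx
  refine ⟨v, hv1, ?_⟩
  have hP : Affine.Point.congrEquiv (tateCurve_baseChange_eq ι hι hq) (.some x y hE) = .some x y hE' := by
    rw [Affine.Point.congrEquiv_some]
  rw [← map_tatePoint_eq ι hι hq0 hq, hv, ← hP, hrt]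

end Compare

omit [CompleteSpace K] [IsUltrametricDist K] [CharZero K] [IsUltrametricDist F] in
/-- `K(a, b)` is finite-dimensional over `K` (`F/K` algebraic). [folklore] -/
private theorem finiteDimensional_adjoin_pair'' (a b : F) :
    FiniteDimensional K (IntermediateField.adjoin K ({a, b} : Set F)) :=
  IntermediateField.finiteDimensional_adjoin fun x _ => (Algebra.IsIntegral.isIntegral (R := K) x)

/-- **`E_{q,1} ⊆ φ(1 + 𝔪)` over an algebraic extension**: a point `(x, y)` of `E_q(F)`, `F/K` an algebraic ultrametric
normed extension of the complete field `K` (`q ∈ K`, `0 < ‖q‖ < 1`), with `‖x‖ > 1` is `tatePointAlg q u` for some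
principal unit `u ∈ Fˣ`, `‖u − 1‖ < 1` — proved in the complete field `K(x, y)` and pushed to `F`.
[cite: SilvermanATAEC1994, §V.4 (PDF p. 401), Thm. V.3.1 (c) (PDF p. 396)] -/
theorem exists_oneUnit_tatePointAlg_eq_of_one_lt_norm (hq0 : q ≠ 0) (hq : ‖q‖ < 1) {x y : F}
    (h : ((tateCurve q).baseChange F).toAffine.Nonsingular x y) (hx : 1 < ‖x‖) :
    ∃ u : Fˣ, ‖(u : F) - 1‖ < 1 ∧ tatePointAlg q u = .some x y h := by
  set E := IntermediateField.adjoin K ({x, y} : Set F)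
  haveI : FiniteDimensional K E := finiteDimensional_adjoin_pair'' x y
  letI : NontriviallyNormedField E := IntermediateField.nontriviallyNormedField E
  haveI : CompleteSpace E := completeSpace_intermediateField K E
  haveI : IsUltrametricDist E := IntermediateField.isUltrametricDist E
  haveI : CharZero E := IntermediateField.charZero' (K := K) E
  have hxE : x ∈ E := IntermediateField.subset_adjoin K _ (by simp)
  have hyE : y ∈ E := IntermediateField.subset_adjoin K _ (by simp)
  set ι : E →ₐ[K] F := E.val
  have hι : ∀ z, ‖ι z‖ = ‖z‖ := fun _ => rfl
  -- `P` is an `E`-rational point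
  have hE : ((tateCurve q).baseChange E).toAffine.Nonsingular (⟨x, hxE⟩ : E) ⟨y, hyE⟩ :=
    ((tateCurve q).toAffine.baseChange_nonsingular (f := ι) ι.injective _ _).mp h
  have hxE1 : 1 < ‖(⟨x, hxE⟩ : E)‖ := hx
  obtain ⟨v, hv1, hv⟩ := exists_oneUnit_tatePointAlg_map_eq ι hι hq0 hq hE hxE1
  refine ⟨Units.map (ι : E →* F) v, hv1, ?_⟩
  rw [hv]
  rfl

end Algebraic

end Literature.NumberTheory.EllipticCurves.TateCurve

end
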